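import Summits.HodgeConjecture.HodgeConjecture.Theses.CYFormCasimir
import Summits.HodgeConjecture.HodgeConjecture.Theorems.CYFormCasimirCYFormCarrierEightCYForm
import Literature.AlgebraicGeometry.HodgeTheory.WeilClassesFourfoldsProofs
import Literature.AlgebraicGeometry.Motives.AbelianVarietyProductDimProofs
import Literature.NumberTheory.EllipticCurves.CMEndomorphismOfMulMemLattice
import HarnessLib
import HarnessLib.Audit

/-!
# Line `birth` (BC3 skeleton + BC5 PLAN-ONLY rung) — crux `CYFormCasimir.CYFormCarrierEight` (X1)
# (item stmt-HodgeConjecture-23493, route route-HodgeConjecture-CYFormCasimir rev 2 74ff4f7423b2) — v4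
# (tribunal-w bc5-witness / scout planner `hodge-cyf-w-1` g0, 2026-08-28; J verdict 73d0fb60f129d296 F1–F2, director g12 plate (B))
# v4 (prover `hodge-cyf-x1-p1` g2, 2026-08-28): STUB 1 `stub_cyform_exists` DISCHARGED by `exact` from the landed Theorems file
# `CYFormCasimirCYFormCarrierEightCYForm` (`Theorems.CYFormCarrier.cyFormExists_eight`, helper files 12–22); statements unchanged.

HONEST FRAMING. Nothing in this file proves X1, the route, rung H2 (`SevenfoldWeilCensus.WeilSixfolds`), HC for
abelian varieties or the Hodge conjecture. TWO statements are SORRIED STUBS (`stub_carrier_of_cyform` — the open realisation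
problem — and the plan-only rung `stub_carrier_at_CM_point`); STUB 1 `stub_cyform_exists` is PROVED (v4); everything else is
packaging proved here.
v3 supersedes the registered v2 (sha 5bc8870f0ad3d86f…, by planner-hodge-idea-2-g2-0, stubs `stub_cyform_exists`,
`stub_carrier_of_cyform`, hypothesis-free `CYFormCarrierEight_of`): the two stubs are RE-TYPED here over the named clause
bundles `IsCYFormAt` / `HasCarrier` (the v2 bytes sit in the gate evidence store, unreadable from this jail) and the BC5
rung stub `stub_carrier_at_CM_point` is ADDED (J designate (a)).

Crux (VERBATIM the route decl, concluded BY NAME below): for every `d > 0` and every Hodge-general split `ℚ(√-d)`-Weil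
eightfold `(A, φ)` (hyperbolic for the symmetrised hyperplane class, Hodge group `SU(4,4)`): a CY form
`T ⊂ H⁴(A.X, ℂ)` (inside `⋀⁴V₊ ⊕ ⋀⁴V₋`, meeting `⋀⁴V₊` trivially, `dim T = 70`, spanned by rational and by pure-type
classes) AND a CARRIER: a smooth projective `Y` (dim `m`), `T_Y ⊂ H⁴(Y)` 70-dimensional, rational, pure-type-spanned, with
`T_Y + Alg²(Y) = H⁴(Y)`, every rational `(4,4)`-class of `span(T_Y·T_Y)` algebraic, and a smooth projective eightfold `W`,
`p : W ↠ A.X`, `f : W → Y` with `f^*T_Y = p^*T`.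

## The two crux stubs (re-typed v2 content; both LOAD-BEARING binders of `CYFormCarrierEight_of`)
* `stub_cyform_exists` — `CYFormExistsEight`: on every Hodge-general split eightfold the CY `ℚ`-form exists:
  `∃ T, IsCYFormAt d A φ T`.  Size M–L (Lombardo 2001 / FL13 §2.4.2 «⋀ⁿH¹(A) contains a Hodge substructure of CY type»
  [corpus:paper:arxiv-1109.5632 p.14]; typing work: `T` as the fixed space of the FL13 Hodge-star `⋆` on `⋀⁴_K H¹`
  [corpus:paper:arxiv-1109.5632 p.19–20, Prop. 37]).  WHY IT MIGHT FAIL: only mis-typing (orientation of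
  `pullbackEigenclasses … ^4` vs `V₊`; the `(Real.sqrt d)`-eigenvalue convention) — the mathematics is in print.
* `stub_carrier_of_cyform` — `CarrierOfCYForm`: every such `T` has a carrier `HasCarrier A T`.  Size XL = THE open
  realisation problem (FL13 p.4 decline realisation; no carrier of Gross's `I_{n,n}` CY-VHS known for `n ≥ 3`; Dolgachev's
  `2n+2` hyperplanes DEAD for `n ≥ 3` [corpus:paper:arxiv-1407.0833 p.2–3, Thm 1.2/1.3]).

## The rung (BC5 / tribunal T3 — PLAN-ONLY; flag `T3-plan-only` expected): `stub_carrier_at_CM_point`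
THE NAMED ANCHOR (constructed here over tree declarations, for every `d > 0`): a CM elliptic curve `(E₀, ψ₀)`,
`E₀.dim = 1`, `ψ₀ ≫ ψ₀ = -d` (`CMEndomorphism.exists_cmCurve_sqrt_neg`), the Weil surface `S_d := E₀ × E₀` with
`φ_S := ψ₀ × (−ψ₀)` and the split CM eightfold `P := S_d⁴ = ((S × S) × S) × S` (complex torus `≅ E₀⁸`, `K = ℚ(√-d)` acting
with signature `(4,4)`: `V₊ = ⟨dz₁,dz₃,dz₅,dz₇, dz̄₂,dz̄₄,dz̄₆,dz̄₈⟩`) with the product action `ψ`; PROVED here: `P.dim = 2·4`,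
`ψ ≫ ψ = -d`.  (The plate's «A ~ E⁸ with ℚ(√-d) diagonal» must be read with signs `(+,−)⁴`: the literally diagonal action
has signature `(8,0)` and is not of Weil type.)
THE RUNG = X1's ∃-conclusion VERBATIM at `(P, ψ)`: `∃ T, IsCYFormAt d P ψ T ∧ HasCarrier P T`, for every `d > 0` and every
CM datum — the Hodge-generality hypotheses of X1 are DROPPED (they fail at a CM point), so this is a rung of the CONCLUSION
(an instance of the carrier problem where `T` is explicit), not an instance of X1's implication; it is neither implied by
nor implies X1, and it is OUTSIDE H2's known regime (H2's proved cell = SPLIT SIXFOLDS,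
`Markman2025_weilClasses_algebraic_hyperbolicSixfold`; the rung lives on an EIGHTFOLD and asks for a GEOMETRIC CARRIER, a
statement no algebraicity theorem for `E₀⁸` supplies).  WHY-clause: HC for `P = E₀⁸` itself is classical (Hodge ring of a
power of a CM elliptic curve = products of divisors; in-tree shape
`SiegelFamilyDiagonalPointsEllipticProducts.divisorClasses_prinPeriod_eq_hodgeClasses_of_coe_eq_diagonal`), so the rung
tests the LEVER (carrier ⇒ transport) and not algebraicity: it is exactly the cheapest-falsifier point of the route header.

SCOUT RESULT (the named candidate, director plate (B)(2); details in `Lines/birth.md`):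
(1) At the anchor the CY form is EXPLICIT and, as a `ℚ`-Hodge structure, `T ≅ H⁴(E₀⁴, ℚ)`: both are representations of the
    CM torus `U(1)_K` with characters `z⁴ (×1), z² (×16), 1 (×36)` + conjugates, i.e. Hodge numbers `(1,16,36,16,1)` =
    `(C(4,a)·C(4,4−a))_a` = `h^{a,4−a}(E₀⁴)`; `Rep_ℚ(U(1)_K)` is semisimple, so the character count decides the iso class.
(2) CANDIDATE CARRIER (J family (c), `m = 4`): `Y := E₀⁴` (or its Kummer model `Bl_{256}(E₀⁴/±1)`, `H¹ = H³ = 0`),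
    `T_Y := H⁴(E₀⁴)` (all of it; resp. its image).  EVERY Y-SIDE CLAUSE HOLDS TRIVIALLY: `finrank T_Y = b₄(E₀⁴) = C(8,4) = 70`;
    rational and pure-type spanned (Betti lattice, Hodge decomposition); `T_Y ⊔ Alg²(Y) = ⊤` because `T_Y = ⊤` (resp. the
    complement is the span of the 256 exceptional `h_i²`); `span(T_Y·T_Y) ⊂ H⁸(Y) = ℂ·[pt]` is algebraic.
(3) THE OPEN CLAUSE IS TRANSPORT: a smooth projective eightfold `W`, `p : W ↠ E₀⁸`, `f : W → Y` with `f^*T_Y = p^*T`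
    in `H⁴(W)`.  NO-GO (exterior algebra, proved by hand, cheapest falsifier of the naive candidates): if
    `f^*H¹(Y) ⊂ p^*H¹(P)` — graphs of homomorphisms `E₀⁸ → E₀⁴`, isogeny correspondences, the Kummer diagram
    `Bl(E₀⁸) → Bl(E₀⁴) → Km(E₀⁴)` — then `f^*T_Y = p^*(⋀⁴U)` for the 8-plane `U = g^*H¹(E₀⁴) ⊂ V₊ ⊕ V₋`, and `⋀⁴U` is
    NEVER the graph `{x + ⋆x}` of the Hodge star (a graph over `⋀⁴V₊` forces `U` to be a graph over `V₊`, whose `⋀⁴` has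
    non-zero `⋀³V₊ ⊗ V₋`-components unless `U = V₊`, and `⋀⁴V₊ ∩ T = 0`).  Hence a carrier at the CM point needs `W` with
    `H¹(W) ⊋ p^*H¹(P)` USED by `f` (Abel–Jacobi mixing: `W = E₀⁴ × M`, `M ↠ E₀⁴` generically finite with extra `H¹`,
    `f = g ⊞ j`; the `j`-terms are contractions `⋀⁴ → ⋀²`, `⋀⁴ → ⋀⁰` against the classes `j_*[·]` — the same algebra as
    `⋆ = ` iterated contraction with the `K`-hermitian form), or a `Y` whose `T_Y` is not generated by `H¹(Y)`.
(4) The CORRESPONDENCE-CARRIER weakening (route KILL CRITERIA pivot: `T_Y ≅ T` induced by an algebraic class on `Y × P`)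
    is TRUE at the anchor with `Y = E₀⁴`: the iso of (1) is a rational `(6,6)`… precisely a Hodge class in
    `H⁴(Y)^∨ ⊗ T ⊂ H¹²(E₀¹²)(·)`, algebraic because every Hodge class on a power of a CM elliptic curve is a polynomial in
    divisors.  So the CM point SEPARATES «carrier» (open, clause-exact) from «correspondence-carrier» (known) — the rung
    is a genuine first prover/refuter target and its failure mode is informative for the route's pivot.
Technique for a prover: (i) `T` := fixed space of `⋆` on `⋀⁴_K H¹(P)` typed through `pullbackEigenclasses` (shares all
work with `stub_cyform_exists`); (ii) `Y, T_Y` as in (2) (`IsSmoothProjective 4 (E₀⁴).X` from the tree's product lemmas);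
(iii) the transport clause by an Abel–Jacobi-mixing `W` as in (3) — OPEN; or REFUTE the clause-exact rung at the anchor
(a Hodge-theoretic obstruction to `f^*T_Y = p^*T` for all smooth `W`), which by the route's KILL CRITERIA pivots X1 to
correspondence-carriers without touching X2/X3.

## Disproof / negatives used
No `Cruxes/CYFormCarrierEight/Disproof.lean` exists (crux born 2026-08-27).  `ledger negatives --problem HodgeConjecture`:
none concerns CY forms, carriers or Weil type in weight 4.  Dead lines honoured: Dolgachev `2n+2`-hyperplane double covers
(SXZ, Zariski-dense monodromy for `n ≥ 3`) are NOT the candidate; the vG–R weight-2 mechanism (`so(6) ≅ ⋀²sl(4)`) is not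
invoked; abelian / Kummer-diagram carriers are excluded by the no-go (3) before any prover time is spent.

## References
[cite: arXiv:1109.5632, §2.4.2 p.14; §4 p.19–20 (Hodge star on ⋀ⁿ_E U, Prop. 37)] [cite: arXiv:math/0008076, Thm. 3.10]
[cite: arXiv:2607.18341, §1.15] [cite: arXiv:1407.0833, Thm. 1.2–1.3] [cite: vanGeemen1994HodgeAV, 5.2–5.4, 6.12]
[cite: doi:10.4153/cmb-2007-049-9 (Cynk–Hulek, Kummer-type quotients of Eⁿ)] [cite: Markman2025SurveySecant, §11.5]
-/

noncomputable section

-- single-problem summit (Problem = Summit): the mandated namespace repeats `HodgeConjecture`.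
set_option linter.dupNamespace false

open CategoryTheory AlgebraicGeometry
open Literature.AlgebraicGeometry Literature.AlgebraicGeometry.Motives Literature.AlgebraicGeometry.HodgeTheory
open Literature.AlgebraicTopology.SingularHomology

namespace Summit.HodgeConjecture.HodgeConjecture.Cruxes.CYFormCarrierEight.Birth

/-! ## §0 The clause bundles of X1, NAMED (verbatim the route text; `cyFormCarrierEight_iff` checks the copy by `Iff.rfl`) -/

/-- The symmetrised hyperplane class `h_K(d, e, a) = d·ι^*a + φ^*ι^*a` (the literal shape in the route decls). -/
abbrev symH (d : ℕ) {A : AbelianVariety ℂ} (φ : A ⟶ A) (e : ProjectiveEmbedding A.X)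
    (a : complexBetti (projectiveSpace e.n ℂ) 2) : complexBetti A.X 2 :=
  (d : ℂ) • complexBetti.map e.ι 2 a + complexBetti.map φ.hom.hom.hom 2 (complexBetti.map e.ι 2 a)

/-- **`IsCYFormAt d A φ T`** — the five `T`-clauses of X1: `T ⊂ ⋀⁴V₊ ⊕ ⋀⁴V₋` (the `(x ± y i√d)⁴`-eigenclasses),
`T ∩ ⋀⁴V₊ = 0`, `dim T = 70`, `T` spanned by its rational classes and by its pure-type classes.
[cite: arXiv:1109.5632, §2.4.2 and Prop. 37] -/
def IsCYFormAt (d : ℕ) (A : AbelianVariety ℂ) (φ : A ⟶ A) (T : Submodule ℂ (complexBetti A.X (2 * 2))) : Prop :=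
  T ≤ Literature.AlgebraicGeometry.HodgeTheory.pullbackEigenclasses A φ (2 * 2) (fun x y => ((x : ℂ) + (y : ℂ) * Complex.I * (Real.sqrt d : ℂ)) ^ 4) ⊔ Literature.AlgebraicGeometry.HodgeTheory.pullbackEigenclasses A φ (2 * 2) (fun x y => ((x : ℂ) - (y : ℂ) * Complex.I * (Real.sqrt d : ℂ)) ^ 4) ∧ T ⊓ Literature.AlgebraicGeometry.HodgeTheory.pullbackEigenclasses A φ (2 * 2) (fun x y => ((x : ℂ) + (y : ℂ) * Complex.I * (Real.sqrt d : ℂ)) ^ 4) = ⊥ ∧ Module.finrank ℂ T = 70 ∧ T ≤ Submodule.span ℂ {c | c ∈ T ∧ Literature.AlgebraicGeometry.HodgeTheory.IsRationalClass c} ∧ T ≤ Submodule.span ℂ {c | c ∈ T ∧ ∃ p q : ℕ, p + q = 4 ∧ Literature.AlgebraicGeometry.HodgeTheory.IsOfHodgeType (2 * 4) A.X (2 * 2) p q c}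

/-- **`HasCarrier A T`** — the carrier block of X1: a smooth projective `Y` of some dimension `m`, a 70-dimensional
`T_Y ⊂ H⁴(Y)` spanned by rational and by pure-type classes with `T_Y ⊔ Alg²(Y) = ⊤`, every rational `(4,4)`-class of
`span(T_Y·T_Y)` algebraic, and a smooth projective eightfold `W`, `p : W ↠ A.X`, `f : W → Y` with `f^*T_Y = p^*T`.
[cite: arXiv:2607.18341, §1.15] [cite: arXiv:1109.5632, p.4] -/
def HasCarrier (A : AbelianVariety ℂ) (T : Submodule ℂ (complexBetti A.X (2 * 2))) : Prop :=
  ∃ (m : ℕ) (Y : Literature.AlgebraicGeometry.Motives.SchemeOver ℂ) (_ : Literature.AlgebraicGeometry.Motives.IsSmoothProjective m Y) (TY : Submodule ℂ (Literature.AlgebraicGeometry.HodgeTheory.complexBetti Y (2 * 2))) (W : Literature.AlgebraicGeometry.Motives.SchemeOver ℂ) (_ : Literature.AlgebraicGeometry.Motives.IsSmoothProjective (2 * 4) W) (p : W ⟶ A.X) (_ : AlgebraicGeometry.Surjective p.left) (f : W ⟶ Y), Module.finrank ℂ TY = 70 ∧ TY ≤ Submodule.span ℂ {c | c ∈ TY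 ∧ Literature.AlgebraicGeometry.HodgeTheory.IsRationalClass c} ∧ TY ≤ Submodule.span ℂ {c | c ∈ TY ∧ ∃ p q : ℕ, p + q = 4 ∧ Literature.AlgebraicGeometry.HodgeTheory.IsOfHodgeType m Y (2 * 2) p q c} ∧ TY ⊔ Literature.AlgebraicGeometry.HodgeTheory.algebraicClasses Y 2 = ⊤ ∧ (∀ c ∈ Submodule.span ℂ {x | ∃ u ∈ TY, ∃ v ∈ TY, x = Literature.AlgebraicTopology.SingularHomology.cupProduct (show 2 * 2 + 2 * 2 = 2 * 4 from rfl) u v}, Literature.AlgebraicGeometry.HodgeTheory.IsRationalClass c → Literature.AlgebraicGeometry.HodgeTheory.IsOfHodgeType m Y (2 * 4) 4 4 c → c ∈ Literature.AlgebraicGeometry.HodgeTheory.algebraicClasses Y 4) ∧ TY.map (Literature.AlgebraicGeometry.HodgeTheory.complexBetti.map f (2 * 2)).hom = T.map (Literature.AlgebraicGeometry.HodgeTheory.complexBetti.map p (2 * 2)).hom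

/-- The route decl IS `∀ …, hypotheses → ∃ T, IsCYFormAt ∧ HasCarrier` (copy check, `Iff.rfl` up to currying). -/
theorem cyFormCarrierEight_iff :
    Summit.HodgeConjecture.HodgeConjecture.Theses.CYFormCasimir.CYFormCarrierEight ↔
      ∀ d : ℕ, 0 < d → ∀ (A : AbelianVariety ℂ) (φ : A ⟶ A) (e : ProjectiveEmbedding A.X)
        (a : complexBetti (projectiveSpace e.n ℂ) 2), A.dim = 2 * 4 → φ ≫ φ = -(d • 𝟙 A) → IsRationalClass a → a ≠ 0 →
        IsHyperbolicWeilType A φ 4 (symH d φ e a) →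
        Literature.AlgebraicGeometry.VanGeemen1994.HasHodgeGroupSU A φ 4 d (symH d φ e a) →
        ∃ T : Submodule ℂ (complexBetti A.X (2 * 2)), IsCYFormAt d A φ T ∧ HasCarrier A T := by
  constructor
  · intro h d hd A φ e a h1 h2 h3 h4 h5 h6
    obtain ⟨T, c1, c2, c3, c4, c5, hc⟩ := h d hd A φ e a h1 h2 h3 h4 h5 h6
    exact ⟨T, ⟨c1, c2, c3, c4, c5⟩, hc⟩
  · intro h d hd A φ e a h1 h2 h3 h4 h5 h6
    obtain ⟨T, ⟨c1, c2, c3, c4, c5⟩, hc⟩ := h d hd A φ e a h1 h2 h3 h4 h5 h6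
    exact ⟨T, c1, c2, c3, c4, c5, hc⟩

/-! ## §1 The named CM anchor `S_d⁴`, `S_d = E₀ × E₀`, `φ_S = ψ₀ × (−ψ₀)`, `ψ₀ ≫ ψ₀ = -d` -/

section Anchor

variable (E₀ : AbelianVariety ℂ) (ψ₀ : E₀ ⟶ E₀)

/-- The Weil surface `S = E₀ × E₀`. -/
abbrev weilSurf : AbelianVariety ℂ := E₀.prod E₀

/-- Its Weil action `φ_S = ψ₀ × (−ψ₀)` (signature `(1,1)`; the tree's `exists_weilType_cmSquare` shape). -/
abbrev weilSurfAct : weilSurf E₀ ⟶ weilSurf E₀ :=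
  AbelianVariety.prodLift (AbelianVariety.fst E₀ E₀ ≫ ψ₀) (AbelianVariety.snd E₀ E₀ ≫ (-ψ₀))

/-- `S² = S × S`. -/
abbrev pad2Anchor : AbelianVariety ℂ := (weilSurf E₀).prod (weilSurf E₀)
/-- `S³ = S² × S`. -/
abbrev pad3Anchor : AbelianVariety ℂ := (pad2Anchor E₀).prod (weilSurf E₀)
/-- **The CM anchor** `P = S⁴ = S³ × S` (complex torus `≅ E₀⁸`; Weil structure `(√-d, −√-d)⁴`, signature `(4,4)`). -/
abbrev pad4Anchor : AbelianVariety ℂ := (pad3Anchor E₀).prod (weilSurf E₀)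

/-- Product action on `S²`. -/
abbrev pad2Action : pad2Anchor E₀ ⟶ pad2Anchor E₀ :=
  AbelianVariety.prodLift (AbelianVariety.fst _ _ ≫ weilSurfAct E₀ ψ₀) (AbelianVariety.snd _ _ ≫ weilSurfAct E₀ ψ₀)
/-- Product action on `S³`. -/
abbrev pad3Action : pad3Anchor E₀ ⟶ pad3Anchor E₀ :=
  AbelianVariety.prodLift (AbelianVariety.fst _ _ ≫ pad2Action E₀ ψ₀) (AbelianVariety.snd _ _ ≫ weilSurfAct E₀ ψ₀)
/-- **The anchor's `K`-action** `ψ = φ_S × φ_S × φ_S × φ_S` on `S⁴`. -/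
abbrev pad4Action : pad4Anchor E₀ ⟶ pad4Anchor E₀ :=
  AbelianVariety.prodLift (AbelianVariety.fst _ _ ≫ pad3Action E₀ ψ₀) (AbelianVariety.snd _ _ ≫ weilSurfAct E₀ ψ₀)

variable {E₀ ψ₀}

/-- `dim S = 2·1`. -/
theorem weilSurf_dim (hE : E₀.dim = 1) : (weilSurf E₀).dim = 2 * 1 := by
  show (E₀.prod E₀).dim = 2 * 1
  rw [AbelianVariety.dim_prod, hE]

/-- **`dim S⁴ = 2·4`.** -/
theorem pad4Anchor_dim (hE : E₀.dim = 1) : (pad4Anchor E₀).dim = 2 * 4 := by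
  have h1 := weilSurf_dim hE
  have h2 : (pad2Anchor E₀).dim = 2 * (1 + 1) := dim_prod_eq_two_mul h1 h1
  have h3 : (pad3Anchor E₀).dim = 2 * ((1 + 1) + 1) := dim_prod_eq_two_mul h2 h1
  have h4 : (pad4Anchor E₀).dim = 2 * (((1 + 1) + 1) + 1) := dim_prod_eq_two_mul h3 h1
  simpa using h4

/-- `(−ψ₀)² = ψ₀²`. -/
theorem neg_comp_neg_eq {d : ℕ} (hψ : ψ₀ ≫ ψ₀ = -(d • 𝟙 E₀)) : (-ψ₀) ≫ (-ψ₀) = -(d • 𝟙 E₀) := by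
  rw [Preadditive.neg_comp_neg]; exact hψ

/-- `φ_S ≫ φ_S = -d`. -/
theorem weilSurfAct_comp_self {d : ℕ} (hψ : ψ₀ ≫ ψ₀ = -(d • 𝟙 E₀)) :
    weilSurfAct E₀ ψ₀ ≫ weilSurfAct E₀ ψ₀ = -(d • 𝟙 (weilSurf E₀)) :=
  prodLift_comp_self_eq_neg_nsmul hψ (neg_comp_neg_eq hψ)

/-- **`ψ ≫ ψ = -d` on `S⁴`.** -/
theorem pad4Action_comp_self {d : ℕ} (hψ : ψ₀ ≫ ψ₀ = -(d • 𝟙 E₀)) :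
    pad4Action E₀ ψ₀ ≫ pad4Action E₀ ψ₀ = -(d • 𝟙 (pad4Anchor E₀)) := by
  have hS := weilSurfAct_comp_self hψ
  have h2 : pad2Action E₀ ψ₀ ≫ pad2Action E₀ ψ₀ = -(d • 𝟙 (pad2Anchor E₀)) :=
    prodLift_comp_self_eq_neg_nsmul hS hS
  have h3 : pad3Action E₀ ψ₀ ≫ pad3Action E₀ ψ₀ = -(d • 𝟙 (pad3Anchor E₀)) :=
    prodLift_comp_self_eq_neg_nsmul h2 hS
  exact prodLift_comp_self_eq_neg_nsmul h3 hS

/-- The anchor exists for every `d > 0` (a CM curve with `ψ₀² = -d` exists: `exists_cmCurve_sqrt_neg`). -/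
theorem exists_anchor (d : ℕ) (hd : 0 < d) :
    ∃ (E₀ : AbelianVariety ℂ) (ψ₀ : E₀ ⟶ E₀), E₀.dim = 1 ∧ ψ₀ ≫ ψ₀ = -(d • 𝟙 E₀) ∧
      (pad4Anchor E₀).dim = 2 * 4 ∧ pad4Action E₀ ψ₀ ≫ pad4Action E₀ ψ₀ = -(d • 𝟙 (pad4Anchor E₀)) := by
  obtain ⟨E₀, ψ₀, hE, hψ⟩ := Literature.NumberTheory.EllipticCurves.CMEndomorphism.exists_cmCurve_sqrt_neg d hd
  exact ⟨E₀, ψ₀, hE, hψ, pad4Anchor_dim hE, pad4Action_comp_self hψ⟩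

end Anchor

/-! ## §2 Registered stubs -/

/-- **STUB 1 — `CYFormExistsEight`** (PROVED in v4): the CY `ℚ`-form `T` exists on every Hodge-general split
`ℚ(√-d)`-Weil eightfold (the fixed space of the rescaled FL13 Hodge star `⋆` on `⋀⁴_K H¹(A)`, read through
`pullbackEigenclasses`; the norm condition `⋆⋆ ∈ Nm(K^×)` comes from the Lagrangian of `IsHyperbolicWeilType`).
LOAD-BEARING binder 1 of `CYFormCarrierEight_of`.
[cite: arXiv:1109.5632, §2.4.2 p.14 and Prop. 37] [cite: arXiv:math/0008076, Thm. 3.10] [cite: vanGeemen1994HodgeAV, 6.12] -/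
theorem stub_cyform_exists :
    ∀ d : ℕ, 0 < d → ∀ (A : AbelianVariety ℂ) (φ : A ⟶ A) (e : ProjectiveEmbedding A.X)
      (a : complexBetti (projectiveSpace e.n ℂ) 2), A.dim = 2 * 4 → φ ≫ φ = -(d • 𝟙 A) → IsRationalClass a → a ≠ 0 →
      IsHyperbolicWeilType A φ 4 (symH d φ e a) →
      Literature.AlgebraicGeometry.VanGeemen1994.HasHodgeGroupSU A φ 4 d (symH d φ e a) →
      ∃ T : Submodule ℂ (complexBetti A.X (2 * 2)), IsCYFormAt d A φ T :=
  -- v4: PROVED — the landed theorem `Theorems.CYFormCarrier.cyFormExists_eight` (file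
  -- `Theorems/CYFormCasimirCYFormCarrierEightCYForm.lean`) has exactly this signature with `symH`, `IsCYFormAt` inlined.
  fun d hd A φ e a hA hφ ha ha0 hhyp hSU ↦
    Summit.HodgeConjecture.HodgeConjecture.Theorems.CYFormCarrier.cyFormExists_eight d hd A φ e a hA hφ ha ha0 hhyp hSU

/-- **STUB 2 — `CarrierOfCYForm` (THE DECIDING STUB: the open realisation problem)**: on a Hodge-general split
eightfold every CY form `T` has a carrier `(Y, T_Y, W, p, f)`.  Size XL / open.  LOAD-BEARING binder 2 of
`CYFormCarrierEight_of`.  Candidate families (route header NOT DECOMPOSED YET + this scout): (a) moduli / Albanese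
carriers on `B × B`, (b) `e₇ = sl₈ ⊕ ⋀⁴ℂ⁸` orbital (Coble-type) varieties, (c) `m = 4` fibration carriers — see the rung
below for the one named at the CM point.  [cite: arXiv:2607.18341, §1.15] [cite: arXiv:1109.5632, p.4] [cite: arXiv:1407.0833, Thm. 1.2] -/
theorem stub_carrier_of_cyform :
    ∀ d : ℕ, 0 < d → ∀ (A : AbelianVariety ℂ) (φ : A ⟶ A) (e : ProjectiveEmbedding A.X)
      (a : complexBetti (projectiveSpace e.n ℂ) 2), A.dim = 2 * 4 → φ ≫ φ = -(d • 𝟙 A) → IsRationalClass a → a ≠ 0 →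
      IsHyperbolicWeilType A φ 4 (symH d φ e a) →
      Literature.AlgebraicGeometry.VanGeemen1994.HasHodgeGroupSU A φ 4 d (symH d φ e a) →
      ∀ T : Submodule ℂ (complexBetti A.X (2 * 2)), IsCYFormAt d A φ T → HasCarrier A T := by
  sorry

/-- **STUB 3 — THE RUNG `stub_carrier_at_CM_point` (BC5 / T3, PLAN-ONLY; J designate (a))**: at the NAMED CM anchor
`P = S_d⁴ ≅ E₀⁸` (`K = ℚ(√-d)` acting by `(ψ₀, −ψ₀)⁴`, signature `(4,4)`), for EVERY `d > 0` and every CM datum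
`(E₀, ψ₀)`: X1's conclusion verbatim — a CY form `T` (here explicit: `T ⊗ ℂ =` graph of `⋆` on `⋀⁴V₊`, and
`T ≅ H⁴(E₀⁴, ℚ)` as a `ℚ`-Hodge structure by the CM-torus character count) TOGETHER WITH A CARRIER.  NAMED CANDIDATE
(family (c), `m = 4`): `Y = E₀⁴` (or `Km(E₀⁴) = Bl_{256}(E₀⁴/±1)`), `T_Y = H⁴(E₀⁴)` — all Y-side clauses trivial
(`b₄ = 70`, Hodge numbers `(1,16,36,16,1)`, `H⁸(Y) = ℂ·pt`); the live clause is TRANSPORT `f^*T_Y = p^*T`, impossible for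
`W` with `f^*H¹(Y) ⊂ p^*H¹(P)` (exterior-algebra no-go: `⋀⁴U` is never the graph of `⋆`), so `W` must be an
Abel–Jacobi-mixing cover (`W = E₀⁴ × M`, `M ↠ E₀⁴` with extra `H¹`, `f = g ⊞ j`).  Outside H2's known regime (split
SIXFOLDS); exercises the lever (carrier + transport), not algebraicity (HC for `E₀⁸` is classical).  NOT a binder of
`CYFormCarrierEight_of` (a rung, strictly beside the crux: X1's hypotheses fail at CM points).
[cite: arXiv:1109.5632, §2.4.2, Prop. 37] [cite: arXiv:math/0008076, Thm. 3.10] [cite: doi:10.4153/cmb-2007-049-9]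
[cite: vanGeemen1994HodgeAV, 5.2–5.4] -/
theorem stub_carrier_at_CM_point :
    ∀ d : ℕ, 0 < d → ∀ (E₀ : AbelianVariety ℂ) (ψ₀ : E₀ ⟶ E₀), E₀.dim = 1 → ψ₀ ≫ ψ₀ = -(d • 𝟙 E₀) →
      ∃ T : Submodule ℂ (complexBetti (pad4Anchor E₀).X (2 * 2)),
        IsCYFormAt d (pad4Anchor E₀) (pad4Action E₀ ψ₀) T ∧ HasCarrier (pad4Anchor E₀) T := by
  sorry

/-! ## §3 Composition (kernel-checked; no `sorry` below this line) -/

/-- **`CYFormCarrierEight_of`** — the two crux stubs give the crux BY NAME: take `T` from STUB 1, its carrier from STUB 2,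
and unpack the clause bundles (the route decl is their inlining, `cyFormCarrierEight_iff`). -/
theorem CYFormCarrierEight_of :
    (∀ d : ℕ, 0 < d → ∀ (A : AbelianVariety ℂ) (φ : A ⟶ A) (e : ProjectiveEmbedding A.X)
      (a : complexBetti (projectiveSpace e.n ℂ) 2), A.dim = 2 * 4 → φ ≫ φ = -(d • 𝟙 A) → IsRationalClass a → a ≠ 0 →
      IsHyperbolicWeilType A φ 4 (symH d φ e a) →
      Literature.AlgebraicGeometry.VanGeemen1994.HasHodgeGroupSU A φ 4 d (symH d φ e a) →
      ∃ T : Submodule ℂ (complexBetti A.X (2 * 2)), IsCYFormAt d A φ T) →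
    (∀ d : ℕ, 0 < d → ∀ (A : AbelianVariety ℂ) (φ : A ⟶ A) (e : ProjectiveEmbedding A.X)
      (a : complexBetti (projectiveSpace e.n ℂ) 2), A.dim = 2 * 4 → φ ≫ φ = -(d • 𝟙 A) → IsRationalClass a → a ≠ 0 →
      IsHyperbolicWeilType A φ 4 (symH d φ e a) →
      Literature.AlgebraicGeometry.VanGeemen1994.HasHodgeGroupSU A φ 4 d (symH d φ e a) →
      ∀ T : Submodule ℂ (complexBetti A.X (2 * 2)), IsCYFormAt d A φ T → HasCarrier A T) →
    Summit.HodgeConjecture.HodgeConjecture.Theses.CYFormCasimir.CYFormCarrierEight := by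
  intro hT hC
  rw [cyFormCarrierEight_iff]
  intro d hd A φ e a h1 h2 h3 h4 h5 h6
  obtain ⟨T, hTT⟩ := hT d hd A φ e a h1 h2 h3 h4 h5 h6
  exact ⟨T, hTT, hC d hd A φ e a h1 h2 h3 h4 h5 h6 T hTT⟩

/-- The same, consuming the registered stubs (so the skeleton audit sees the crux concluded BY NAME from `stub_*`). -/
theorem CYFormCarrierEight_of_stubs :
    Summit.HodgeConjecture.HodgeConjecture.Theses.CYFormCasimir.CYFormCarrierEight :=
  CYFormCarrierEight_of stub_cyform_exists stub_carrier_of_cyform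

/-- The rung packaged with the anchor's Weil-type certificate: for every `d > 0` SOME split CM `ℚ(√-d)`-eightfold of
dimension `2·4` with `ψ² = -d` carries a CY form with a carrier (from STUB 3 and `exists_anchor`). -/
theorem exists_cm_eightfold_with_carrier_of_stub
    (h : ∀ d : ℕ, 0 < d → ∀ (E₀ : AbelianVariety ℂ) (ψ₀ : E₀ ⟶ E₀), E₀.dim = 1 → ψ₀ ≫ ψ₀ = -(d • 𝟙 E₀) →
      ∃ T : Submodule ℂ (complexBetti (pad4Anchor E₀).X (2 * 2)),
        IsCYFormAt d (pad4Anchor E₀) (pad4Action E₀ ψ₀) T ∧ HasCarrier (pad4Anchor E₀) T)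
    (d : ℕ) (hd : 0 < d) :
    ∃ (P : AbelianVariety ℂ) (ψ : P ⟶ P), P.dim = 2 * 4 ∧ ψ ≫ ψ = -(d • 𝟙 P) ∧
      ∃ T : Submodule ℂ (complexBetti P.X (2 * 2)), IsCYFormAt d P ψ T ∧ HasCarrier P T := by
  obtain ⟨E₀, ψ₀, hE, hψ, hdim, hsq⟩ := exists_anchor d hd
  exact ⟨pad4Anchor E₀, pad4Action E₀ ψ₀, hdim, hsq, h d hd E₀ ψ₀ hE hψ⟩

end Summit.HodgeConjecture.HodgeConjecture.Cruxes.CYFormCarrierEight.Birth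

end
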